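import Summits.QuantumAdvantage.QuantumAdvantage.Theorems.CubicForrelationNearExactIsExactTwelveTypeO936
import Summits.QuantumAdvantage.QuantumAdvantage.Theorems.CubicForrelationNearExactIsExactTwelveLevelFive932

/-!
# Crux `CubicForrelation.NearExactIsExact` (stmt-QuantumAdvantage-14043) — n = 12: a TYPE-O side with a base set of `896` points is impossible
  for `Φ > 932/1024`; the type-O branch on `(932/1024, 936/1024)` reduces to the second Kasami–Tokura gap `(896, 960)` of `RM(3,12)`

Certificate seat `b2b-cforr-cert` (gen 18).  HONEST FRAMING: kernel-checked lemmas (standard axioms, no `decide`/`native_decide`) about cubic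
Boolean pairs on 12 bits — the type-O branch BELOW the value `936/1024` settled by gen 18 (`…TwelveClosed936`).  No new value of `θ₁₂` is
claimed here.  Finite-slice statements; NOT summit progress.

`to18_typeO_E896_false`: cubic `f, g` with `W_g = 16u`, all `u` odd (type O), base set `#E = 896` (`E = {d₁ = d₂}`) and `Φ > 932/1024`
do not exist.  Proof (the wild-point version of `to18_typeO_ge936_false`): `τ = u − 4(−1)^f = τ₀ + 8v` with `Σ τ₀² = 11264`, excess
`X = τ² − τ₀² = 16v(τ₀ + 4v) ≥ 16v²`, `Σ X = 2¹⁷(1 − Φ) − 11264 < 512`, so `Σ v² < 32`.  Walsh inversion and the character sums of `E`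
(`to18_char_sum_E896`, multiples of `128`) give `Σ_x v(x)(−1)^{x·y} = 8·K(y)` with `K(y) ≡ u_f(y) (mod 2)`, `W_f = 16u_f`.  By the type-O
dichotomy for `f` (`typeO_of_exists_odd`): EITHER all `u_f` odd — then every `|Σ_x v(−1)^{x·y}| ≥ 8`, Parseval for `v` gives `Σ v² ≥ 64`,
contradiction; OR all `u_f` even — then `f` is at level `≥ 5`, level 5 is dead above `932/1024` (`tw15_levelFive_932_false` for `(g, f)`), so
`4 ∣ u_f`, `4 ∣ K`, `32 ∣ Σ_x v(−1)^{x·y}`, while `|Σ_x v(−1)^{x·y}| ≤ Σ v² < 32`: the transform of `v` vanishes, `v ≡ 0`, the excess is `0`,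
`Φ = 936/1024 ≥ 936/1024` — excluded by `to18_typeO_ge936_false`.
`to18_typeO_gt932_weight`: consequently a type-O side with `Φ > 932/1024` has a base set `E` (the support of a CUBIC on 12 bits) with
`896 < #E < 960` — strictly inside the second Kasami–Tokura gap of `RM(3,12)` (Kasami–Tokura 1970: no such weight exists; NOT in the tree —
the tree's classification-free gap theorem `kt_gap_cubic` stops at `1.75d = 896`).  So the values `933, 934, 935 (/1024)` are attained by a
pair with a type-O side only if a cubic on 12 bits has weight in `{904, …, 952}`.

References: Ax (1964) / McEliece (1972); Kasami–Tokura (1970) Thm 1; MacWilliams–Sloane (1977) Ch. 15; O'Donnell (2014) §3.3.  Axioms: standard.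
-/

set_option linter.dupNamespace false -- D-0017: single-problem summit ⇒ `QuantumAdvantage.QuantumAdvantage` by design

noncomputable section

namespace Summit.QuantumAdvantage.QuantumAdvantage.Theorems.CubicForrelation.NearExactIsExact

open Finset
open Literature.Computability.QuantumComplexity
open Literature.Computability.QuantumComplexity.BuzetChailloux (bxor zeroVec bxor_bxor_cancel_left bxor_zeroVec zeroVec_bxor bxor_comm
  bxor_self twist_zeroVec_right twist_bxor_right signOf_sq)
open Literature.Computability.QuantumComplexity.DerivativeWalsh (W sum_W_sq)
open Summit.QuantumAdvantage.QuantumAdvantage.Theorems.NearExactIsExact.Negative (TypeOTwelve.typeO_of_exists_odd)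

/-! ### No base set of `896` points above `932/1024` -/

/-- **A type-O side with a base set of `896` points is impossible for `Φ > 932/1024` (12 bits).**  See the module docstring.  Finite-slice
statement; NOT summit progress. [this work] -/
theorem to18_typeO_E896_false (f g : (Fin (6 + 6) → Bool) → Bool) (hf : IsDegLeFun 3 f) (hg : IsDegLeFun 3 g)
    (u : (Fin (6 + 6) → Bool) → ℤ) (hu : ∀ x, W (fun y => signOf (g y)) x = (2 : ℝ) ^ 4 * (u x : ℝ))
    (hodd : ∃ x, Odd (u x)) (hE : #(univ.filter fun x : Fin (6 + 6) → Bool => (Odd (u x / 2) ↔ Odd (u x / 2 / 2))) = 896)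
    (hΦ : (932 / 1024 : ℝ) < forrelation f g) : False := by
  classical
  have hΦlt : forrelation f g < 936 / 1024 := to18_typeO_lt_936 f g hf hg u hu hodd
  have hall : ∀ x, Odd (u x) := TypeOTwelve.typeO_of_exists_odd g u hg hu hodd
  have hu' : ∀ x, W (fun y => signOf (g y)) x = (2 : ℝ) ^ (2 * 2) * (u x : ℝ) := fun x => (hu x).trans (by norm_num)
  have hd1 : IsDegLeFun 1 (fun x => decide (Odd (u x / 2))) := z2_digitOne 2 g u hg hu' hall
  have hd2 : IsDegLeFun 3 (fun x => decide (Odd (u x / 2 / 2))) := z2_digitTwo 2 g u hg hu' hall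
  set E := univ.filter (fun x : Fin (6 + 6) → Bool => (Odd (u x / 2) ↔ Odd (u x / 2 / 2))) with hEdef
  have hdegE : IsDegLeFun (2 + 1) (fun x => (decide (Odd (u x / 2)) ^^ decide (Odd (u x / 2 / 2))) ^^ true) :=
    tb_isDegLeFun_xor_const (bb_isDegLeFun_bxor (hd1.mono (by norm_num)) hd2) true
  have hsetE : (univ.filter fun x : Fin (6 + 6) → Bool =>
      ((decide (Odd (u x / 2)) ^^ decide (Odd (u x / 2 / 2))) ^^ true) = true) = E := by
    rw [hEdef]
    apply filter_congr
    intro x _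
    by_cases h1 : Odd (u x / 2) <;> by_cases h2 : Odd (u x / 2 / 2) <;> simp [h1, h2]
  have hsumE : (∑ x, (if (Odd (u x / 2) ↔ Odd (u x / 2 / 2)) then 1 else 0 : ℤ)) = #E := by rw [sum_boole]
  -- budget `Σ τ² = 2¹⁷(1 − Φ) < 11776`
  have hbud := tw12_budget f g u hu
  have hT : (∑ x, (u x - 4 * sZ (f x)) ^ 2 : ℤ) < 11776 := by
    have h' : ((∑ x, (u x - 4 * sZ (f x)) ^ 2 : ℤ) : ℝ) < 11776 := by rw [hbud]; linarith
    exact_mod_cast h'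
  -- base pattern `τ₀` and wild function `v`: `τ = τ₀ + 8v`
  choose v hv using fun x => to12_pt_mod8 (u x) (sZ (f x)) (hall x) (tp_sZ_cases (f x))
  set τ₀ : (Fin (6 + 6) → Bool) → ℤ := fun x =>
    sZ (decide (Odd (u x / 2))) * (1 - 4 * (if (Odd (u x / 2) ↔ Odd (u x / 2 / 2)) then 1 else 0)) with hτ₀def
  have hvx : ∀ x, u x - 4 * sZ (f x) = τ₀ x + 8 * v x := fun x => hv x
  have hτ₀val : ∀ x, τ₀ x = 1 ∨ τ₀ x = -1 ∨ τ₀ x = 3 ∨ τ₀ x = -3 := by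
    intro x
    simp only [τ₀]
    rcases tp_sZ_cases (decide (Odd (u x / 2))) with h | h <;> rw [h] <;> split_ifs <;> norm_num
  have hτ₀sq : ∀ x, τ₀ x ^ 2 = 1 + 8 * (if (Odd (u x / 2) ↔ Odd (u x / 2 / 2)) then 1 else 0 : ℤ) := by
    intro x
    simp only [τ₀]
    rcases tp_sZ_cases (decide (Odd (u x / 2))) with h | h <;> rw [h] <;> split_ifs <;> norm_num
  have hsumτ₀ : ∑ x, τ₀ x ^ 2 = 11264 := by
    rw [sum_congr rfl fun x _ => hτ₀sq x, sum_add_distrib, ← mul_sum, hsumE, sum_const, card_univ, Fintype.card_fun,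
      Fintype.card_bool, Fintype.card_fin, hE]
    norm_num
  -- excess `X = τ² − τ₀² ≥ 16 v²`, `Σ X < 512`, hence `Σ v² < 32`
  set X : (Fin (6 + 6) → Bool) → ℤ := fun x => (τ₀ x + 8 * v x) ^ 2 - τ₀ x ^ 2 with hXdef
  have hXv : ∀ x, 16 * v x ^ 2 ≤ X x := by
    intro x
    have hid : X x - 16 * v x ^ 2 = 16 * (v x * (3 * v x + τ₀ x)) := by simp only [X]; ring
    have hτ3 : -3 ≤ τ₀ x ∧ τ₀ x ≤ 3 := by rcases hτ₀val x with h | h | h | h <;> rw [h] <;> norm_num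
    have hprod : 0 ≤ v x * (3 * v x + τ₀ x) := by
      rcases lt_trichotomy (v x) 0 with h0 | h0 | h0
      · exact mul_nonneg_of_nonpos_of_nonpos h0.le (by linarith)
      · rw [h0]; simp
      · exact mul_nonneg h0.le (by linarith)
    linarith
  have hTdec : (∑ x, (u x - 4 * sZ (f x)) ^ 2 : ℤ) = ∑ x, τ₀ x ^ 2 + ∑ x, X x := by
    rw [← sum_add_distrib]
    exact sum_congr rfl fun x _ => by rw [hvx x]; simp only [X]; ring
  have hXsum : ∑ x, X x < 512 := by rw [hTdec, hsumτ₀] at hT; linarith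
  have hv2 : ∑ x, v x ^ 2 < 32 := by
    have : 16 * ∑ x, v x ^ 2 ≤ ∑ x, X x := by rw [mul_sum]; exact sum_le_sum fun x _ => hXv x
    linarith
  -- the affine digit as a character and the `E`-indicator as the support of the cubic `cE`
  obtain ⟨c₁, b₁, hcb⟩ := stub_affineForm (6 + 6) _ hd1
  have hsb : signOf b₁ = 1 ∨ signOf b₁ = -1 := by cases b₁ <;> simp [signOf]
  set cE : (Fin (6 + 6) → Bool) → Bool := fun x => (decide (Odd (u x / 2)) ^^ decide (Odd (u x / 2 / 2))) ^^ true with hcEdef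
  have hcE3 : IsDegLeFun 3 cE := hdegE
  have hcE896 : #(univ.filter fun x => cE x = true) = 896 := by rw [hsetE, hE]
  have hcEiff : ∀ x, cE x = true ↔ (Odd (u x / 2) ↔ Odd (u x / 2 / 2)) := by
    intro x; simp only [cE]; by_cases h1 : Odd (u x / 2) <;> by_cases h2 : Odd (u x / 2 / 2) <;> simp [h1, h2]
  have hτ₀R : ∀ x, (τ₀ x : ℝ) = signOf b₁ * twist c₁ x * (1 - 4 * (if cE x = true then 1 else 0)) := by
    intro x
    simp only [τ₀]
    push_cast
    rw [tp_sZ_cast, hcb x]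
    by_cases h : (Odd (u x / 2) ↔ Odd (u x / 2 / 2))
    · rw [if_pos h, if_pos ((hcEiff x).2 h)]
    · rw [if_neg h, if_neg (fun h' => h ((hcEiff x).1 h'))]
  -- the partner at the Ax level: `W_f = 16 u_f`
  obtain ⟨uf, huf⟩ := tw_base (n := 6 + 6) f hf 4 (by norm_num)
  -- Walsh inversion: `64 u_f(y) = 256 (−1)^{g(y)} − Σ_x τ₀ twist − 8 Σ_x v twist`
  have hinvg : ∀ y, ∑ x, (u x : ℝ) * twist x y = 256 * signOf (g y) := by
    intro y
    have h := tz_inversion (fun y => signOf (g y)) y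
    rw [sum_congr rfl fun x _ => by rw [hu x]] at h
    have h' : (2 : ℝ) ^ 4 * ∑ x, (u x : ℝ) * twist x y = 2 ^ (6 + 6) * signOf (g y) := by
      rw [mul_sum]; rw [← h]; exact sum_congr rfl fun x _ => by ring
    have e16 : (2 : ℝ) ^ (6 + 6) = 2 ^ 4 * 256 := by norm_num
    rw [e16, mul_assoc] at h'
    exact mul_left_cancel₀ (by positivity) h'
  have hWv : ∀ y, W (fun x => (v x : ℝ)) y = ∑ x, (v x : ℝ) * twist x y := fun y => rfl
  have h64 : ∀ y, 64 * (uf y : ℝ) = 256 * signOf (g y) - ∑ x, (τ₀ x : ℝ) * twist x y - 8 * W (fun x => (v x : ℝ)) y := by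
    intro y
    have hW4 : 4 * W (fun x => signOf (f x)) y = ∑ x, 4 * (signOf (f x) * twist x y) := by unfold W; rw [mul_sum]
    have e64 : 64 * (uf y : ℝ) = 4 * W (fun x => signOf (f x)) y := by rw [huf y]; ring
    rw [e64, hW4, hWv y, mul_sum, ← hinvg y, ← sum_sub_distrib, ← sum_sub_distrib]
    refine sum_congr rfl fun x _ => ?_
    have h := hvx x
    have h' : ((u x : ℤ) : ℝ) - 4 * (sZ (f x) : ℝ) = (τ₀ x : ℝ) + 8 * (v x : ℝ) := by exact_mod_cast h
    rw [tp_sZ_cast] at h'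
    have : (4 : ℝ) * signOf (f x) = (u x : ℝ) - (τ₀ x : ℝ) - 8 * (v x : ℝ) := by linarith
    rw [show (4 : ℝ) * (signOf (f x) * twist x y) = (4 * signOf (f x)) * twist x y by ring, this]; ring
  have hτ₀sum : ∀ y, ∑ x, (τ₀ x : ℝ) * twist x y =
      signOf b₁ * ((if bxor c₁ y = (fun _ => false) then (2 : ℝ) ^ (6 + 6) else 0) -
        4 * ∑ x ∈ univ.filter (fun x => cE x = true), twist x (bxor c₁ y)) := by
    intro y
    have e1 : ∀ x, (τ₀ x : ℝ) * twist x y = signOf b₁ * twist x (bxor c₁ y) -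
        signOf b₁ * (4 * (if cE x = true then twist x (bxor c₁ y) else 0)) := by
      intro x
      rw [hτ₀R x, twist_bxor_right, twist_comm x c₁]; split_ifs <;> ring
    rw [sum_congr rfl fun x _ => e1 x, sum_sub_distrib, ← mul_sum, ← mul_sum, ← mul_sum, tz_sum_twist_left, ← sum_filter]
    ring
  -- hence `Σ_x v twist = 8 K(y)` with `K(y) + u_f(y)` even
  have hK : ∀ y, ∃ K : ℤ, W (fun x => (v x : ℝ)) y = 8 * (K : ℝ) ∧ (4 : ℤ) ∣ K + uf y := by
    intro y
    obtain ⟨m, hm⟩ := to18_char_sum_E896 cE hcE3 hcE896 (bxor c₁ y)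
    have h := h64 y
    rw [hτ₀sum y, hm] at h
    have hsg : signOf (g y) = 1 ∨ signOf (g y) = -1 := by cases g y <;> simp [signOf]
    by_cases h0 : bxor c₁ y = (fun _ => false)
    · rw [if_pos h0] at h
      rcases hsb with hs | hs <;> rw [hs] at h <;> rcases hsg with hg' | hg' <;> rw [hg'] at h <;> norm_num at h
      · exact ⟨4 - 64 + 8 * m - uf y, by push_cast; linarith, ⟨1 - 16 + 2 * m, by ring⟩⟩
      · exact ⟨-4 - 64 + 8 * m - uf y, by push_cast; linarith, ⟨-1 - 16 + 2 * m, by ring⟩⟩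
      · exact ⟨4 + 64 - 8 * m - uf y, by push_cast; linarith, ⟨1 + 16 - 2 * m, by ring⟩⟩
      · exact ⟨-4 + 64 - 8 * m - uf y, by push_cast; linarith, ⟨-1 + 16 - 2 * m, by ring⟩⟩
    · rw [if_neg h0] at h
      rcases hsb with hs | hs <;> rw [hs] at h <;> rcases hsg with hg' | hg' <;> rw [hg'] at h <;> norm_num at h
      · exact ⟨4 + 8 * m - uf y, by push_cast; linarith, ⟨1 + 2 * m, by ring⟩⟩
      · exact ⟨-4 + 8 * m - uf y, by push_cast; linarith, ⟨-1 + 2 * m, by ring⟩⟩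
      · exact ⟨4 - 8 * m - uf y, by push_cast; linarith, ⟨1 - 2 * m, by ring⟩⟩
      · exact ⟨-4 - 8 * m - uf y, by push_cast; linarith, ⟨-1 - 2 * m, by ring⟩⟩
  choose K hKW hKpar using hK
  -- the transform of `v` is small: `|Σ_x v twist| ≤ Σ v² < 32`
  have hWsmall : ∀ y, |W (fun x => (v x : ℝ)) y| < 32 := by
    intro y
    have h1 : |W (fun x => (v x : ℝ)) y| ≤ ∑ x, ((v x : ℝ)) ^ 2 := by
      rw [hWv y]
      refine (abs_sum_le_sum_abs _ _).trans (sum_le_sum fun x _ => ?_)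
      rw [abs_mul]
      have ht : |twist x y| = 1 := by
        rcases Literature.Computability.QuantumComplexity.Simon.twist_eq_one_or x y with h | h <;> rw [h] <;> norm_num
      rw [ht, mul_one]
      have : |(v x : ℝ)| ≤ (v x : ℝ) ^ 2 := by
        rcases le_or_gt 0 (v x) with h0 | h0
        · have h0' : (0 : ℝ) ≤ v x := by exact_mod_cast h0
          rw [abs_of_nonneg h0']
          rcases eq_or_lt_of_le h0 with h00 | h00
          · rw [← h00]; norm_num
          · have : (1 : ℝ) ≤ v x := by exact_mod_cast h00
            nlinarith
        · have h0' : (v x : ℝ) < 0 := by exact_mod_cast h0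
          rw [abs_of_neg h0']
          have : (v x : ℝ) ≤ -1 := by exact_mod_cast (show v x ≤ -1 by omega)
          nlinarith
      exact this
    have h2 : ∑ x, ((v x : ℝ)) ^ 2 < 32 := by exact_mod_cast hv2
    linarith
  -- Parseval for `v`: `Σ_y (Σ_x v twist)² = 4096 Σ v²`
  have hParsv : ∑ y, W (fun x => (v x : ℝ)) y ^ 2 = 4096 * ∑ x, ((v x : ℝ)) ^ 2 := by
    rw [sum_W_sq]; norm_num
  -- the type-O dichotomy for the partner
  by_cases hfodd : ∃ y, Odd (uf y)
  · -- all `u_f` odd: every `K` is odd, `|Σ v twist| ≥ 8`, `Σ v² ≥ 64`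
    have hallf : ∀ y, Odd (uf y) := TypeOTwelve.typeO_of_exists_odd f uf hf huf hfodd
    have hK1 : ∀ y, 64 ≤ W (fun x => (v x : ℝ)) y ^ 2 := by
      intro y
      have hKodd : Odd (K y) := by
        obtain ⟨a, ha⟩ := hallf y
        obtain ⟨b, hb⟩ := hKpar y
        exact ⟨2 * b - a - 1, by linarith⟩
      have h0 := Int.odd_iff.1 hKodd
      have hK' : K y ≤ -1 ∨ 1 ≤ K y := by omega
      have hsq : (1 : ℤ) ≤ K y ^ 2 := tp_sq_ge (k := 1) (by norm_num) hK'
      have hsqR : (1 : ℝ) ≤ (K y : ℝ) ^ 2 := by exact_mod_cast hsq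
      rw [hKW y]; nlinarith
    have h64 : (64 : ℝ) * 4096 ≤ ∑ y, W (fun x => (v x : ℝ)) y ^ 2 := by
      have h := sum_le_sum fun y (_ : y ∈ (univ : Finset (Fin (6 + 6) → Bool))) => hK1 y
      rw [sum_const, card_univ, Fintype.card_fun, Fintype.card_bool, Fintype.card_fin] at h
      norm_num at h ⊢
      linarith
    have h2 : ∑ x, ((v x : ℝ)) ^ 2 < 32 := by exact_mod_cast hv2
    rw [hParsv] at h64
    linarith
  · -- all `u_f` even: the partner is at level `≥ 5`; level 5 is dead above `932/1024`, so `4 ∣ u_f`, `32 ∣ Σ v twist`, hence `v ≡ 0`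
    push Not at hfodd
    have hΦ' : forrelation g f = forrelation f g := by
      rw [Summit.QuantumAdvantage.QuantumAdvantage.Theorems.SignedCubicForrelationNotPrBPP.Negative.HalfQuad.forrelation_comm]
    have huf' : ∀ x, W (fun y => signOf (f y)) x = (2 : ℝ) ^ 5 * (((uf x / 2 : ℤ)) : ℝ) := fun x => by
      rw [tw_level_up f uf huf hfodd x]
    have huf'ev : ∀ x, ¬ Odd (uf x / 2) := fun x hx =>
      tw15_levelFive_932_false g f hg hf (fun x => uf x / 2) huf' ⟨x, hx⟩ (by rw [hΦ']; linarith)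
    have h4 : ∀ y, (4 : ℤ) ∣ uf y := by
      intro y
      have h2 : (2 : ℤ) ∣ uf y := even_iff_two_dvd.1 (Int.not_odd_iff_even.1 (hfodd y))
      have h2' : (2 : ℤ) ∣ uf y / 2 := even_iff_two_dvd.1 (Int.not_odd_iff_even.1 (huf'ev y))
      obtain ⟨a, ha⟩ := h2'
      exact ⟨a, by have := Int.mul_ediv_cancel' h2; rw [← this, ha]; ring⟩
    have hW0 : ∀ y, W (fun x => (v x : ℝ)) y = 0 := by
      intro y
      have hK4 : (4 : ℤ) ∣ K y := by
        obtain ⟨a, ha⟩ := h4 y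
        obtain ⟨b, hb⟩ := hKpar y
        exact ⟨b - a, by linarith⟩
      obtain ⟨c, hc⟩ := hK4
      have hW : W (fun x => (v x : ℝ)) y = 32 * (c : ℝ) := by rw [hKW y, hc]; push_cast; ring
      have hs := hWsmall y
      rw [hW, abs_mul, show |(32 : ℝ)| = 32 by norm_num] at hs
      have hc1 : |(c : ℝ)| < 1 := by linarith
      have hc0 : c = 0 := by
        have : |c| < 1 := by exact_mod_cast hc1
        rw [abs_lt] at this; omega
      rw [hW, hc0]; simp
    have hv0 : ∀ x, v x = 0 := by
      intro x
      have h := tz_inversion (fun x => (v x : ℝ)) x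
      rw [sum_eq_zero fun y _ => by rw [hW0 y, zero_mul]] at h
      have : (v x : ℝ) = 0 := by
        have h' : (2 : ℝ) ^ (6 + 6) * (v x : ℝ) = 0 := h.symm
        exact (mul_eq_zero.1 h').resolve_left (by positivity)
      exact_mod_cast this
    -- zero excess: `Φ = 936/1024`
    have hT0 : (∑ x, (u x - 4 * sZ (f x)) ^ 2 : ℤ) = 11264 := by
      rw [hTdec, hsumτ₀, sum_eq_zero (fun x _ => by simp only [X]; rw [hv0 x]; ring)]; norm_num
    have hΦeq : forrelation f g = 936 / 1024 := by
      have h' : ((∑ x, (u x - 4 * sZ (f x)) ^ 2 : ℤ) : ℝ) = 11264 := by exact_mod_cast hT0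
      rw [hbud] at h'
      linarith
    linarith

/-- **The type-O branch for `932/1024 < Φ` reduces to the second Kasami–Tokura gap of `RM(3,12)`**: a type-O side (`W_g = 16u`, some `u`
odd) with `Φ(f,g) > 932/1024` has a base set `E = {d₁ = d₂}` — the support of a cubic Boolean function on 12 bits — with `896 < #E < 960`.
(Kasami–Tokura: no such cubic exists; that classification is not in the tree.)  Finite-slice statement; NOT summit progress. [this work] -/
theorem to18_typeO_gt932_weight (f g : (Fin (6 + 6) → Bool) → Bool) (hf : IsDegLeFun 3 f) (hg : IsDegLeFun 3 g)
    (u : (Fin (6 + 6) → Bool) → ℤ) (hu : ∀ x, W (fun y => signOf (g y)) x = (2 : ℝ) ^ 4 * (u x : ℝ))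
    (hodd : ∃ x, Odd (u x)) (hΦ : (932 / 1024 : ℝ) < forrelation f g) :
    896 < #(univ.filter fun x : Fin (6 + 6) → Bool => (Odd (u x / 2) ↔ Odd (u x / 2 / 2))) ∧
    #(univ.filter fun x : Fin (6 + 6) → Bool => (Odd (u x / 2) ↔ Odd (u x / 2 / 2))) < 960 := by
  classical
  have hall : ∀ x, Odd (u x) := TypeOTwelve.typeO_of_exists_odd g u hg hu hodd
  have hu' : ∀ x, W (fun y => signOf (g y)) x = (2 : ℝ) ^ (2 * 2) * (u x : ℝ) := fun x => (hu x).trans (by norm_num)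
  have hd1 : IsDegLeFun 1 (fun x => decide (Odd (u x / 2))) := z2_digitOne 2 g u hg hu' hall
  have hd2 : IsDegLeFun 3 (fun x => decide (Odd (u x / 2 / 2))) := z2_digitTwo 2 g u hg hu' hall
  set E := univ.filter (fun x : Fin (6 + 6) → Bool => (Odd (u x / 2) ↔ Odd (u x / 2 / 2))) with hEdef
  have hdegE : IsDegLeFun (2 + 1) (fun x => (decide (Odd (u x / 2)) ^^ decide (Odd (u x / 2 / 2))) ^^ true) :=
    tb_isDegLeFun_xor_const (bb_isDegLeFun_bxor (hd1.mono (by norm_num)) hd2) true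
  have hsetE : (univ.filter fun x : Fin (6 + 6) → Bool =>
      ((decide (Odd (u x / 2)) ^^ decide (Odd (u x / 2 / 2))) ^^ true) = true) = E := by
    rw [hEdef]
    apply filter_congr
    intro x _
    by_cases h1 : Odd (u x / 2) <;> by_cases h2 : Odd (u x / 2 / 2) <;> simp [h1, h2]
  have hsumE : (∑ x, (if (Odd (u x / 2) ↔ Odd (u x / 2 / 2)) then 1 else 0 : ℤ)) = #E := by rw [sum_boole]
  have hE768 : 768 ≤ #E := to15_typeO_E_ge_768 f g hf hg u hu hodd (by linarith)
  have hEne : #E ≠ 768 := by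
    intro h
    have := to15_typeO_E768_le f g hf hg u hu hodd h
    linarith
  have hE896 : #E ≠ 896 := fun h => to18_typeO_E896_false f g hf hg u hu hodd h hΦ
  -- budget: `4096 + 8#E ≤ Σ τ² = 2¹⁷(1 − Φ) < 11776`
  have hbud := tw12_budget f g u hu
  have hT : (∑ x, (u x - 4 * sZ (f x)) ^ 2 : ℤ) < 11776 := by
    have h' : ((∑ x, (u x - 4 * sZ (f x)) ^ 2 : ℤ) : ℝ) < 11776 := by rw [hbud]; linarith
    exact_mod_cast h'
  choose v hv using fun x => to12_pt_mod8 (u x) (sZ (f x)) (hall x) (tp_sZ_cases (f x))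
  set τ₀ : (Fin (6 + 6) → Bool) → ℤ := fun x =>
    sZ (decide (Odd (u x / 2))) * (1 - 4 * (if (Odd (u x / 2) ↔ Odd (u x / 2 / 2)) then 1 else 0)) with hτ₀def
  have hτ₀val : ∀ x, τ₀ x = 1 ∨ τ₀ x = -1 ∨ τ₀ x = 3 ∨ τ₀ x = -3 := by
    intro x
    simp only [τ₀]
    rcases tp_sZ_cases (decide (Odd (u x / 2))) with h | h <;> rw [h] <;> split_ifs <;> norm_num
  have hτ₀sq : ∀ x, τ₀ x ^ 2 = 1 + 8 * (if (Odd (u x / 2) ↔ Odd (u x / 2 / 2)) then 1 else 0 : ℤ) := by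
    intro x
    simp only [τ₀]
    rcases tp_sZ_cases (decide (Odd (u x / 2))) with h | h <;> rw [h] <;> split_ifs <;> norm_num
  have hsumτ₀ : ∑ x, τ₀ x ^ 2 = 4096 + 8 * #E := by
    rw [sum_congr rfl fun x _ => hτ₀sq x, sum_add_distrib, ← mul_sum, hsumE, sum_const, card_univ, Fintype.card_fun,
      Fintype.card_bool, Fintype.card_fin]
    norm_num
  have hXnn : ∀ x, 0 ≤ (τ₀ x + 8 * v x) ^ 2 - τ₀ x ^ 2 := fun x => to12_excess_nonneg _ _ (hτ₀val x)
  have hTge : ∑ x, τ₀ x ^ 2 ≤ (∑ x, (u x - 4 * sZ (f x)) ^ 2 : ℤ) := by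
    refine sum_le_sum fun x _ => ?_
    rw [hv x]
    linarith [hXnn x]
  have hElt : #E < 960 := by
    rw [hsumτ₀] at hTge
    have : (8 : ℤ) * #E < 7680 := by linarith
    have : 8 * #E < 7680 := by exact_mod_cast this
    omega
  refine ⟨?_, hElt⟩
  by_contra hle
  push Not at hle
  rcases lt_or_eq_of_le hle with hlt | heq
  · rcases lt_or_eq_of_le hE768 with hlt' | heq'
    · exact kt_gap_twelve _ hdegE (by rw [hsetE]; exact hlt') (by rw [hsetE]; exact hlt)
    · exact hEne heq'.symm
  · exact hE896 heq

end Summit.QuantumAdvantage.QuantumAdvantage.Theorems.CubicForrelation.NearExactIsExact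

end
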